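import Literature.NumberTheory.Automorphic.UnitaryGroupFinAdelicCenterLocal
import Literature.NumberTheory.Automorphic.UnitaryGroupPlaceInclusion
import HarnessLib

/-!
# The dual pair with a hermitian LINE, place by place: `U(J_V)(F_v) →* U(J_V ⊗ J_W)(F_v)`, `k ↦ reindex (k ⊗ 1)`

Topic `NumberTheory/Automorphic`; namespace `Literature.NumberTheory.Automorphic.UnitaryGroup`.  KERNEL ONLY: one
definition with body (`localLineInl`, plus its matrix-level form `localLineGL`) and theorems; no record, no named fact,
no `sorry`.  Local companion of `UnitaryGroupDualPairReindex` (`finPairEmb : U(J_V)(𝔸_f) × U(J_W)(𝔸_f) →* U(J_{VW})(𝔸_f)`,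
`(k, u) ↦ reindex e (k ⊗ₖ u)`, [GelbartRogawski1991, §3.2 p. 457]) and of `UnitaryGroupFinAdelicCenterLocal` (the centre
place by place): for a hermitian LINE `J_W ∈ M_1(E)` ([Liu2021, App. D §D.1]: `U(V_ε) = U(V)`), the FIRST member of the
pair read on the factor `U(J_V)(F_v) ≤ Π_{w ∣ v} GL_N(E_w)` of `U(J_V)(𝔸_f) = Πʳ_v U(J_V)(F_v)`:

* §1 `localLineGL e v : Π_{w∣v} GL_N(E_w) →* Π_{w∣v} GL_n(E_w)`, `(k_w)_w ↦ (reindex e (k_w ⊗ 1))_w`, and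
  `localLineInl … e J_W v : U(J_V)(F_v) →* U(J_V ⊗ J_W)(F_v)` (`J_{VW} = reindex e e (J_V ⊗ₖ J_W)`; membership by
  `(c_* (k ⊗ 1))ᵀ (J_V ⊗ J_W) (k ⊗ 1) = ((c_* k)ᵀ J_V k) ⊗ J_W`, place by place), integral on integral points
  (`localLineInl_mapsTo_localInt`), compatible with the local centre (`localLineInl_localCenter`: `(z·1_N) ⊗ 1 = z·1_n`),
  and — `W` being a line — SURJECTIVE (`localLineInl_surjective`);
* §2 **compatibility with the finite-adelic pair embedding**: the `v`-component of `reindex e (k ⊗ 1)` is `localLineInl v`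
  of the `v`-component of `k` (`finAdelicEquiv_finPairEmb_inl`), i.e. `finAdelicEquiv (finPairEmb (k, 1)) =
  Πʳ(localLineInl) (finAdelicEquiv k)` (`…_eq_mapAlong`), whence on the coordinate embedding of a place:
  `finAdelicEquiv (finPairEmb (inclPlace v g, 1)) = Πʳ(localLineInl) (mulSingle v g)` (`finAdelicEquiv_finPairEmb_inclPlace`) —
  the hypothesis `hsq` of `Liu2021/Def411WeilCarriersLocalIsotypy` (local isotypy of [Liu2021, Def. 4.11]'s `ω(μ, ε, χ)`)
  at the consumer's local groups `U(J_V)(F_v)`.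

Everything is elementary matrix bookkeeping over the tree's `finPairEmb` ∕ `finAdelicEquiv` ∕ `inclPlace` ∕ `localCenter`;
no published theorem is cited as a hypothesis.  Cell pub-hodgecm2 (COR-CM), Δ2 BRIDGE cite legs; seat prover-pub-hodgecm2-b10-g68-0.

## References
* [GelbartRogawski1991] S. Gelbart, J. Rogawski, Invent. Math. 105 (1991), §3.2 p. 457 (`a : U(V) → G₁`, `g ↦ g ⊗ 1`).
* [Liu2021] Y. Liu, Camb. J. Math. 9 (2021) = arXiv:2102.11518, App. D §D.1 (l. 5213–5224), Def. 4.11 (l. 2092–2096).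
* [MoeglinVignerasWaldspurger1987] C. Mœglin, M.-F. Vignéras, J.-L. Waldspurger, LNM 1291, Chap. 1 I.17 (dual pairs).
* [PlatonovRapinchuk1994] V. Platonov, A. Rapinchuk, *Algebraic Groups and Number Theory* (1994), §5.1.
-/

set_option autoImplicit false

noncomputable section

open scoped Matrix Kronecker RestrictedProduct Classical
open NumberField IsDedekindDomain Filter Set

namespace Literature.NumberTheory.Automorphic.UnitaryGroup

variable (F E : Type) [Field F] [NumberField F] [Field E] [NumberField E] [Algebra F E]
variable (c : E ≃ₐ[F] E) (N : ℕ) {n : ℕ} (e : Fin N × Fin 1 ≃ Fin n)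
variable (JV : Matrix (Fin N) (Fin N) E) (JW : Matrix (Fin 1) (Fin 1) E)

/-! ## §1 `k ↦ reindex e (k ⊗ 1)` on the factor `Π_{w ∣ v} GL(E_w)` and on `U(J_V)(F_v)` -/

section Local

variable {F}

/-- `(k_w)_w ↦ (reindex e (k_w ⊗ₖ 1_1))_w` on `Π_{w ∣ v} GL_N(E_w) → Π_{w ∣ v} GL_n(E_w)`.
[cite: MoeglinVignerasWaldspurger1987, Chap. 1 I.17] -/
def localLineGL (v : HeightOneSpectrum (𝓞 F)) : LocalGLPi E N v →* LocalGLPi E n v where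
  toFun k w := reindexGL e (kroneckerGL (k w, 1))
  map_one' := funext fun w => by rw [Pi.one_apply, Pi.one_apply, ← Prod.one_eq_mk, map_one, map_one]
  map_mul' k k' := funext fun w => by rw [Pi.mul_apply, Pi.mul_apply, ← map_mul, ← map_mul, Prod.mk_mul_mk, mul_one]

omit [NumberField F] in
/-- matrix of the `w`-component: `reindex e e (k_w ⊗ₖ 1)`. [cite: MoeglinVignerasWaldspurger1987, Chap. 1 I.17] -/
theorem coe_localLineGL_apply (v : HeightOneSpectrum (𝓞 F)) (k : LocalGLPi E N v) (w : PlacesOver E v) :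
    ((localLineGL E N e v k w : GL (Fin n) (w.1.adicCompletion E)) : Matrix (Fin n) (Fin n) (w.1.adicCompletion E)) =
      Matrix.reindex e e (((k w : GL (Fin N) (w.1.adicCompletion E)) : Matrix (Fin N) (Fin N) (w.1.adicCompletion E)) ⊗ₖ
        (1 : Matrix (Fin 1) (Fin 1) (w.1.adicCompletion E))) := by
  rw [show localLineGL E N e v k w = reindexGL e (kroneckerGL (k w, 1)) from rfl, coe_reindexGL, coe_kroneckerGL,
    Units.val_one]

omit [NumberField F] in
/-- matrix of the inverse of the `w`-component: `reindex e e (k_w⁻¹ ⊗ₖ 1)`. [cite: MoeglinVignerasWaldspurger1987, Chap. 1 I.17] -/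
theorem coe_localLineGL_apply_inv (v : HeightOneSpectrum (𝓞 F)) (k : LocalGLPi E N v) (w : PlacesOver E v) :
    (((localLineGL E N e v k w)⁻¹ : GL (Fin n) (w.1.adicCompletion E)) : Matrix (Fin n) (Fin n) (w.1.adicCompletion E)) =
      Matrix.reindex e e ((((k w)⁻¹ : GL (Fin N) (w.1.adicCompletion E)) : Matrix (Fin N) (Fin N) (w.1.adicCompletion E)) ⊗ₖ
        (1 : Matrix (Fin 1) (Fin 1) (w.1.adicCompletion E))) := by
  rw [← Pi.inv_apply, ← map_inv]
  exact coe_localLineGL_apply E N e v k⁻¹ w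

omit [NumberField F] in
/-- the form of `V ⊗ W` at `w`: `placeForm (reindex e e (J_V ⊗ₖ J_W)) w = reindex e e (placeForm J_V w ⊗ₖ placeForm J_W w)`.
[cite: GelbartRogawski1991, §3.1 p. 454] -/
theorem placeForm_reindex_kronecker (w : HeightOneSpectrum (𝓞 E)) :
    placeForm (Matrix.reindex e e (JV ⊗ₖ JW)) w = Matrix.reindex e e (placeForm JV w ⊗ₖ placeForm JW w) := by
  rw [placeForm, placeForm, placeForm, kronecker_map_map]
  rfl

/-- the unitarity expression of `reindex e (k ⊗ 1)` at `w` is `reindex e (((c_* k)ᵀ J_V k) ⊗ J_W)`: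
`(c_*(k ⊗ 1))ᵀ (J_V ⊗ J_W) (k ⊗ 1) = ((c_* k)ᵀ J_V k) ⊗ (1ᵀ J_W 1)`. [cite: MoeglinVignerasWaldspurger1987, Chap. 1 I.17] -/
theorem localLineGL_form (v : HeightOneSpectrum (𝓞 F)) (k : LocalGLPi E N v) (w : PlacesOver E v) :
    (((localLineGL E N e v k (PlacesOver.galInv c w) : GL (Fin n) ((PlacesOver.galInv c w).1.adicCompletion E)) :
            Matrix (Fin n) (Fin n) ((PlacesOver.galInv c w).1.adicCompletion E)).map
          (galAdicCompletionMap c (smul_inv_smul c w.1)))ᵀ * placeForm (Matrix.reindex e e (JV ⊗ₖ JW)) w.1 *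
        ((localLineGL E N e v k w : GL (Fin n) (w.1.adicCompletion E)) : Matrix (Fin n) (Fin n) (w.1.adicCompletion E)) =
      Matrix.reindex e e
        (((((k (PlacesOver.galInv c w) : GL (Fin N) ((PlacesOver.galInv c w).1.adicCompletion E)) :
                Matrix (Fin N) (Fin N) ((PlacesOver.galInv c w).1.adicCompletion E)).map
              (galAdicCompletionMap c (smul_inv_smul c w.1)))ᵀ * placeForm JV w.1 *
            ((k w : GL (Fin N) (w.1.adicCompletion E)) : Matrix (Fin N) (Fin N) (w.1.adicCompletion E))) ⊗ₖ
          placeForm JW w.1) := by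
  rw [coe_localLineGL_apply, coe_localLineGL_apply, placeForm_reindex_kronecker, Matrix.reindex_apply,
    Matrix.reindex_apply, Matrix.reindex_apply, Matrix.reindex_apply, ← Matrix.submatrix_map, Matrix.transpose_submatrix,
    ← kronecker_map_map, kronecker_transpose, Matrix.map_one _ (map_zero _) (map_one _), Matrix.transpose_one,
    Matrix.submatrix_mul_equiv,
    Matrix.submatrix_mul_equiv, ← Matrix.mul_kronecker_mul, ← Matrix.mul_kronecker_mul, Matrix.one_mul, Matrix.mul_one]

omit [NumberField F] [NumberField E] in
/-- cancellation of a non-degenerate LINE factor: `X ⊗ (j) = P ⊗ (j)` with `j ≠ 0` forces `X = P` (private helper). [folklore] -/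
private theorem kronecker_lineForm_cancel {R : Type*} [CommRing R] [NoZeroDivisors R] {m : Type*}
    {B : Matrix (Fin 1) (Fin 1) R} (hB : B 0 0 ≠ 0) {X P : Matrix m m R} (h : X ⊗ₖ B = P ⊗ₖ B) : X = P := by
  ext a b
  have hab := congrFun (congrFun h (a, 0)) (b, 0)
  simp only [Matrix.kroneckerMap_apply] at hab
  exact mul_right_cancel₀ hB hab

/-- **`reindex e (k ⊗ 1) ∈ U(J_V ⊗ J_W)(F_v)` iff `k ∈ U(J_V)(F_v)`** (`J_W = (j)`, `j ≠ 0`): `(c_*(k ⊗ 1))ᵀ (J_V ⊗ J_W) (k ⊗ 1) =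
((c_* k)ᵀ J_V k) ⊗ J_W` place by place over `v`, and `X ⊗ (j) = J_V ⊗ (j)` forces `X = J_V`.
[cite: MoeglinVignerasWaldspurger1987, Chap. 1 I.17] -/
theorem localLineGL_mem_iff (hJW0 : JW 0 0 ≠ 0) (v : HeightOneSpectrum (𝓞 F)) (k : LocalGLPi E N v) :
    localLineGL E N e v k ∈ localPi E c n (Matrix.reindex e e (JV ⊗ₖ JW)) v ↔ k ∈ localPi E c N JV v := by
  rw [mem_localPi_iff, mem_localPi_iff]
  refine forall_congr' fun w => ?_
  rw [localLineGL_form, placeForm_reindex_kronecker, (Matrix.reindex e e).apply_eq_iff_eq]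
  refine ⟨fun h => ?_, fun h => by rw [h]⟩
  have hj : placeForm JW w.1 0 0 ≠ 0 := by
    rw [placeForm, Matrix.map_apply]
    exact (map_ne_zero _).2 hJW0
  exact kronecker_lineForm_cancel hj h

/-- `reindex e (k ⊗ 1) ∈ U(J_V ⊗ J_W)(F_v)` for `k ∈ U(J_V)(F_v)` (any `J_W`). [cite: MoeglinVignerasWaldspurger1987, Chap. 1 I.17] -/
theorem localLineGL_mem (v : HeightOneSpectrum (𝓞 F)) (k : localPi E c N JV v) :
    localLineGL E N e v (k : LocalGLPi E N v) ∈ localPi E c n (Matrix.reindex e e (JV ⊗ₖ JW)) v := by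
  rw [mem_localPi_iff]
  intro w
  rw [localLineGL_form, (mem_localPi_iff E c N JV v (k : LocalGLPi E N v)).1 k.2 w, placeForm_reindex_kronecker]

/-- **`localLineInl … v : U(J_V)(F_v) →* U(J_V ⊗ J_W)(F_v)`, `k ↦ reindex e (k ⊗ 1)`** — the first member of the
dual pair at the place `v` ([GelbartRogawski1991, §3.2]'s `a : U(V) → G₁` read on the factor `U(J)(F_v)`).
[cite: GelbartRogawski1991, §3.2 p. 457] -/
def localLineInl (v : HeightOneSpectrum (𝓞 F)) : localPi E c N JV v →* localPi E c n (Matrix.reindex e e (JV ⊗ₖ JW)) v :=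
  ((localLineGL E N e v).comp (localPi E c N JV v).subtype).codRestrict _ fun k => localLineGL_mem E c N e JV JW v k

/-- underlying family of `localLineInl v k`. [cite: GelbartRogawski1991, §3.2 p. 457] -/
@[simp] theorem coe_localLineInl (v : HeightOneSpectrum (𝓞 F)) (k : localPi E c N JV v) :
    ((localLineInl E c N e JV JW v k : localPi E c n (Matrix.reindex e e (JV ⊗ₖ JW)) v) : LocalGLPi E n v) =
      localLineGL E N e v (k : LocalGLPi E N v) := rfl

/-- **`localLineInl` maps `U(J_V)(𝒪_v)` into `U(J_V ⊗ J_W)(𝒪_v)`** (the entries of `k ⊗ 1` and of `k⁻¹ ⊗ 1` are entries of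
`k`, `k⁻¹` or `0`). [cite: PlatonovRapinchuk1994, §5.1] -/
theorem localLineInl_mapsTo_localInt (v : HeightOneSpectrum (𝓞 F)) :
    MapsTo (localLineInl E c N e JV JW v)
      ((localInt E c N JV v : Subgroup (localPi E c N JV v)) : Set (localPi E c N JV v))
      ((localInt E c n (Matrix.reindex e e (JV ⊗ₖ JW)) v : Subgroup (localPi E c n (Matrix.reindex e e (JV ⊗ₖ JW)) v)) :
        Set (localPi E c n (Matrix.reindex e e (JV ⊗ₖ JW)) v)) := by
  intro k hk
  rw [SetLike.mem_coe, mem_localInt_iff] at hk ⊢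
  intro w
  obtain ⟨h1, h2⟩ := (mem_glInt_iff _).1 (hk w)
  rw [coe_localLineInl, mem_glInt_iff]
  refine ⟨fun i j => ?_, fun i j => ?_⟩
  · rw [coe_localLineGL_apply, Matrix.reindex_apply, Matrix.submatrix_apply, Matrix.kroneckerMap_apply, Matrix.one_apply]
    split_ifs
    · rw [mul_one]; exact h1 _ _
    · rw [mul_zero]; exact zero_mem _
  · rw [coe_localLineGL_apply_inv, Matrix.reindex_apply, Matrix.submatrix_apply, Matrix.kroneckerMap_apply, Matrix.one_apply]
    split_ifs
    · rw [mul_one]; exact h2 _ _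
    · rw [mul_zero]; exact zero_mem _

/-- `localLineInl` maps integral points to integral points at EVERY place (the `∀ᶠ` form used by `Πʳ`).
[cite: PlatonovRapinchuk1994, §5.1] -/
theorem eventually_localLineInl_mapsTo_localInt :
    ∀ᶠ v : HeightOneSpectrum (𝓞 F) in cofinite, MapsTo (localLineInl E c N e JV JW v)
      ((localInt E c N JV v : Subgroup (localPi E c N JV v)) : Set (localPi E c N JV v))
      ((localInt E c n (Matrix.reindex e e (JV ⊗ₖ JW)) v : Subgroup (localPi E c n (Matrix.reindex e e (JV ⊗ₖ JW)) v)) :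
        Set (localPi E c n (Matrix.reindex e e (JV ⊗ₖ JW)) v)) :=
  Eventually.of_forall fun v => localLineInl_mapsTo_localInt E c N e JV JW v

/-- **compatibility with the local centre**: `(z · 1_N) ⊗ 1 = z · 1_n`, i.e. `localLineInl v ∘ localCenter_{J_V} v =
localCenter_{J_V ⊗ J_W} v`. [cite: Mok2014, §1 Notation p. 5] -/
theorem localLineInl_localCenter (J₁ : Matrix (Fin 1) (Fin 1) E) (hJ₁ : J₁ 0 0 ≠ 0) (v : HeightOneSpectrum (𝓞 F))
    (z : localPi E c 1 J₁ v) :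
    localLineInl E c N e JV JW v (localCenter E c N JV J₁ hJ₁ v z) =
      localCenter E c n (Matrix.reindex e e (JV ⊗ₖ JW)) J₁ hJ₁ v z := by
  refine Subtype.ext (funext fun w => Units.ext ?_)
  rw [coe_localLineInl, coe_localLineGL_apply, coe_localCenter, coe_localCenter, coe_localScalarGL_apply,
    coe_localScalarGL_apply, Matrix.smul_kronecker, Matrix.one_kronecker_one]
  ext i j
  simp only [Matrix.reindex_apply, Matrix.submatrix_apply, Matrix.smul_apply, Matrix.one_apply,
    EmbeddingLike.apply_eq_iff_eq]

/-- `Fin N ≃ Fin n` induced by `e : Fin N × Fin 1 ≃ Fin n` (non-Prop plumbing for `localLineInl_surjective`). [folklore] -/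
private def lineIndex (e : Fin N × Fin 1 ≃ Fin n) : Fin N ≃ Fin n := (Equiv.prodUnique (Fin N) (Fin 1)).symm.trans e

omit [NumberField F] [NumberField E] in
/-- `reindex e ((reindex along lineIndex⁻¹) M ⊗ 1) = M`: `k ⊗ 1` read back on `Fin n` (private helper). [folklore] -/
private theorem reindex_lineIndex_kronecker_one {R : Type*} [CommRing R] (M : Matrix (Fin n) (Fin n) R) :
    Matrix.reindex e e (Matrix.reindex (lineIndex N e).symm (lineIndex N e).symm M ⊗ₖ (1 : Matrix (Fin 1) (Fin 1) R)) = M := by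
  ext i j
  have h1 : ∀ x : Fin N × Fin 1, (x.1, (default : Fin 1)) = x := fun x => Prod.ext rfl (Subsingleton.elim _ _)
  have h2 : ∀ a b : Fin 1, (1 : Matrix (Fin 1) (Fin 1) R) a b = 1 := fun a b => by
    rw [Subsingleton.elim a b, Matrix.one_apply_eq]
  simp only [Matrix.reindex_apply, Matrix.submatrix_apply, Matrix.kroneckerMap_apply, Equiv.symm_symm, h2, mul_one]
  show M (e ((e.symm i).1, default)) (e ((e.symm j).1, default)) = M i j
  rw [h1, h1, Equiv.apply_symm_apply, Equiv.apply_symm_apply]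

/-- **for a LINE `W`, `localLineInl v` is onto** (`U(V ⊗ W) = U(V)` when `dim W = 1`, [Liu2021, App. D §D.1]):
every `g ∈ U(J_V ⊗ J_W)(F_v)` is `reindex e (k ⊗ 1)` with `k_w := (i, j) ↦ (g_w)_{e(i,0), e(j,0)}`.
[cite: Liu2021, App. D §D.1 (l. 5213–5224)] -/
theorem localLineInl_surjective (hJW0 : JW 0 0 ≠ 0) (v : HeightOneSpectrum (𝓞 F)) :
    Function.Surjective (localLineInl E c N e JV JW v) := by
  intro g
  let k : LocalGLPi E N v := fun w => reindexGL (lineIndex N e).symm ((g : LocalGLPi E n v) w)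
  have hk : localLineGL E N e v k = (g : LocalGLPi E n v) := by
    refine funext fun w => Units.ext ?_
    rw [coe_localLineGL_apply, show k w = reindexGL (lineIndex N e).symm ((g : LocalGLPi E n v) w) from rfl, coe_reindexGL,
      reindex_lineIndex_kronecker_one]
  have hkmem : k ∈ localPi E c N JV v := by
    rw [← localLineGL_mem_iff E c N e JV JW hJW0 v k, hk]
    exact g.2
  exact ⟨⟨k, hkmem⟩, Subtype.ext hk⟩

end Local

/-! ## §2 Compatibility with the finite-adelic pair embedding `finPairEmb` -/

section Global

variable {F}

/-- **the `v`-component of `reindex e (k ⊗ 1)` is `localLineInl v` of the `v`-component of `k`.**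
[cite: GelbartRogawski1991, §3.2 p. 457] -/
theorem finAdelicEquiv_finPairEmb_inl (k : finAdelic F E c N JV) (v : HeightOneSpectrum (𝓞 F)) :
    finAdelicEquiv F E c n (Matrix.reindex e e (JV ⊗ₖ JW)) (finPairEmb F E c N 1 e JV JW (k, 1)) v =
      localLineInl E c N e JV JW v (finAdelicEquiv F E c N JV k v) := by
  refine Subtype.ext (funext fun w => Units.ext ?_)
  rw [finAdelicEquiv_apply_coe, coe_localLineInl, coe_localLineGL_apply, finAdelicEquiv_apply_coe, ← map_eval_eq_evalAt,
    ← map_eval_eq_evalAt]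
  simp only [coe_finPairEmb, coe_reindexGL, coe_kroneckerGL, OneMemClass.coe_one, Units.val_one]
  rw [Matrix.reindex_apply, Matrix.reindex_apply, ← Matrix.submatrix_map, ← kronecker_map_map,
    Matrix.map_one _ (map_zero _) (map_one _)]

/-- the same in `Πʳ_v`: `finAdelicEquiv (reindex e (k ⊗ 1)) = Πʳ(localLineInl) (finAdelicEquiv k)`.
[cite: GelbartRogawski1991, §3.2 p. 457] -/
theorem finAdelicEquiv_finPairEmb_inl_eq_mapAlong (k : finAdelic F E c N JV) :
    (finAdelicEquiv F E c n (Matrix.reindex e e (JV ⊗ₖ JW)) (finPairEmb F E c N 1 e JV JW (k, 1)) :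
        Πʳ v : HeightOneSpectrum (𝓞 F), [localPi E c n (Matrix.reindex e e (JV ⊗ₖ JW)) v,
          localInt E c n (Matrix.reindex e e (JV ⊗ₖ JW)) v]) =
      RestrictedProduct.mapAlongMonoidHom (fun v => localPi E c N JV v)
        (fun v => localPi E c n (Matrix.reindex e e (JV ⊗ₖ JW)) v) id Filter.tendsto_id
        (fun v => localLineInl E c N e JV JW v) (eventually_localLineInl_mapsTo_localInt E c N e JV JW)
        (finAdelicEquiv F E c N JV k) :=
  RestrictedProduct.ext _ _ fun v => finAdelicEquiv_finPairEmb_inl E c N e JV JW k v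

/-- **on the coordinate embedding of a place**: `finAdelicEquiv (reindex e (inclPlace v g ⊗ 1)) = Πʳ(localLineInl) (mulSingle v g)`
— the hypothesis `hsq` of `Liu2021/Def411WeilCarriersLocalIsotypy` at the local groups `U(J_V)(F_v)` with `ψ_v = localLineInl v`,
`φloc = inclPlace v`. [cite: PlatonovRapinchuk1994, §5.1] -/
theorem finAdelicEquiv_finPairEmb_inclPlace (v : HeightOneSpectrum (𝓞 F)) (g : localPi E c N JV v) :
    (finAdelicEquiv F E c n (Matrix.reindex e e (JV ⊗ₖ JW)) (finPairEmb F E c N 1 e JV JW (inclPlace F E c N JV v g, 1)) :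
        Πʳ v : HeightOneSpectrum (𝓞 F), [localPi E c n (Matrix.reindex e e (JV ⊗ₖ JW)) v,
          localInt E c n (Matrix.reindex e e (JV ⊗ₖ JW)) v]) =
      RestrictedProduct.mapAlongMonoidHom (fun v => localPi E c N JV v)
        (fun v => localPi E c n (Matrix.reindex e e (JV ⊗ₖ JW)) v) id Filter.tendsto_id
        (fun v => localLineInl E c N e JV JW v) (eventually_localLineInl_mapsTo_localInt E c N e JV JW)
        (mulSingleHom (fun v : HeightOneSpectrum (𝓞 F) => localInt E c N JV v) v g) :=
  (finAdelicEquiv_finPairEmb_inl_eq_mapAlong E c N e JV JW (inclPlace F E c N JV v g)).trans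
    (congrArg _ (finAdelicEquiv_inclPlace F E c N JV v g))

end Global

end Literature.NumberTheory.Automorphic.UnitaryGroup

end
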